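import Literature.FieldTheory.ReducedFiniteAlgebraPiFields
import Literature.NumberTheory.NumberFields.CompletionLocalDegree
import HarnessLib

/-!
# Finitely many reduced (étale) algebras of bounded dimension over the completion of a number field

The number-field instance of `Literature.FieldTheory.exists_finite_representatives_padic`: for a
number field `F`, a finite place `w` and a bound `N`, there is a FINITE family of commutative
`F_w`-algebras such that every reduced commutative `F_w`-algebra of dimension `≤ N` is
`F_w`-isomorphic to one of them (`F_w = w.adicCompletion F`). The `ℚ_p`-structure on `F_w`
(`p` the residue characteristic of `w`) is the tree's canonical
`LocalField.adicCompletionPadicAlgebra`, of finite degree `e_w f_w`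
(`Literature.NumberTheory.NumberFields.finrank_adicCompletionPadicAlgebra_eq`); the statement
itself mentions no `p`.

Motivation (hodgecm, CARTAN-FIN road): the étale `L⁺_v`-algebra attached to a regular semisimple
element of `U(N)(L⁺_v)` ranges over finitely many isomorphism types. Theorems only.
[cite: BombieriGubler2006, Prop 4.5.3] [cite: AtiyahMacdonald1969, Thm 8.7]
-/

noncomputable section

open Module NumberField IsDedekindDomain

namespace Literature.NumberTheory.LocalFields

universe v

variable (F : Type) [Field F] [NumberField F] (w : HeightOneSpectrum (𝓞 F))

/-- The residue characteristic of a finite place: a rational prime `p` with `p ∈ 𝔭_w`. [folklore] -/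
private theorem exists_prime_natCast_mem_asIdeal :
    ∃ p : ℕ, p.Prime ∧ ((p : ℕ) : 𝓞 F) ∈ w.asIdeal := by
  obtain ⟨q, hq⟩ := CharP.exists (𝓞 F ⧸ w.asIdeal)
  have hqprime : q.Prime := (CharP.char_is_prime_or_zero (𝓞 F ⧸ w.asIdeal) q).resolve_right
    (CharP.char_ne_zero_of_finite (𝓞 F ⧸ w.asIdeal) q)
  refine ⟨q, hqprime, ?_⟩
  rw [← Ideal.Quotient.eq_zero_iff_mem, map_natCast]
  exact CharP.cast_eq_zero _ q

/-- **Finitely many reduced commutative `F_w`-algebras of dimension `≤ N`, up to isomorphism**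
(`F` a number field, `w` a finite place, `F_w = w.adicCompletion F`): a finite representative
family exists. From `Literature.FieldTheory.exists_finite_representatives_padic` at the canonical
`ℚ_p`-structure of `F_w`. [cite: BombieriGubler2006, Prop 4.5.3] [cite: AtiyahMacdonald1969, Thm 8.7] -/
theorem exists_finite_representatives_adicCompletion (N : ℕ) :
    ∃ (ι : Type) (_ : Finite ι) (R : ι → Type) (_ : ∀ i, CommRing (R i))
      (_ : ∀ i, Algebra (w.adicCompletion F) (R i)),
      ∀ (A : Type v) [CommRing A] [Algebra (w.adicCompletion F) A] [IsReduced A]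
        [FiniteDimensional (w.adicCompletion F) A],
        finrank (w.adicCompletion F) A ≤ N → ∃ i, Nonempty (A ≃ₐ[w.adicCompletion F] R i) := by
  obtain ⟨p, hp, hpv⟩ := exists_prime_natCast_mem_asIdeal F w
  haveI : Fact p.Prime := ⟨hp⟩
  letI : Algebra ℚ_[p] (w.adicCompletion F) :=
    Literature.NumberTheory.GaloisRepresentations.LocalField.adicCompletionPadicAlgebra w p hpv
  haveI : FiniteDimensional ℚ_[p] (w.adicCompletion F) := by
    apply Module.finite_of_finrank_pos
    rw [Literature.NumberTheory.NumberFields.finrank_adicCompletionPadicAlgebra_eq p w hpv]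
    exact Nat.mul_pos (Ideal.ramificationIdx_pos _ _) (Ideal.inertiaDeg_pos _ _)
  exact Literature.FieldTheory.exists_finite_representatives_padic p (w.adicCompletion F) N

/-- **Variant over a finite extension of a completion** (e.g. `K = L_w` over `F_w = L⁺_v` for a
CM extension `L ⊇ L⁺`): for EVERY field `K` finite over `w.adicCompletion F`, a finite
representative family of the reduced commutative `K`-algebras of dimension `≤ N` exists (the
`ℚ_p`-structure of `K` is the composite one, of finite degree by the tower law).
[cite: BombieriGubler2006, Prop 4.5.3] [cite: AtiyahMacdonald1969, Thm 8.7] -/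
theorem exists_finite_representatives_of_finite_adicCompletion (K : Type) [Field K]
    [Algebra (w.adicCompletion F) K] [FiniteDimensional (w.adicCompletion F) K] (N : ℕ) :
    ∃ (ι : Type) (_ : Finite ι) (R : ι → Type) (_ : ∀ i, CommRing (R i))
      (_ : ∀ i, Algebra K (R i)),
      ∀ (A : Type v) [CommRing A] [Algebra K A] [IsReduced A] [FiniteDimensional K A],
        finrank K A ≤ N → ∃ i, Nonempty (A ≃ₐ[K] R i) := by
  obtain ⟨p, hp, hpv⟩ := exists_prime_natCast_mem_asIdeal F w
  haveI : Fact p.Prime := ⟨hp⟩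
  letI : Algebra ℚ_[p] (w.adicCompletion F) :=
    Literature.NumberTheory.GaloisRepresentations.LocalField.adicCompletionPadicAlgebra w p hpv
  haveI : FiniteDimensional ℚ_[p] (w.adicCompletion F) := by
    apply Module.finite_of_finrank_pos
    rw [Literature.NumberTheory.NumberFields.finrank_adicCompletionPadicAlgebra_eq p w hpv]
    exact Nat.mul_pos (Ideal.ramificationIdx_pos _ _) (Ideal.inertiaDeg_pos _ _)
  letI : Algebra ℚ_[p] K := ((algebraMap (w.adicCompletion F) K).comp (algebraMap ℚ_[p] _)).toAlgebra
  haveI : IsScalarTower ℚ_[p] (w.adicCompletion F) K := IsScalarTower.of_algebraMap_eq fun _ => rfl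
  haveI : FiniteDimensional ℚ_[p] K := Module.Finite.trans (w.adicCompletion F) K
  exact Literature.FieldTheory.exists_finite_representatives_padic p K N


/-! ## ED. 2 appendix: the hypothesis `hfin` over `AlgebraicClosure` at a completion and over its finite extensions -/

/-- **`hfin` at a completion**: the intermediate fields `F_w ⊆ E ⊆ AlgebraicClosure F_w` of
`F_w`-degree `≤ d` form a finite set (`F` a number field, `w` a finite place). Discharges the
hypothesis `hfin` of ★ `Rogawski1990.exists_finset_cartanAlgebra_types` at `F = L⁺`, `w = v`.
[cite: BombieriGubler2006, Prop 4.5.3] -/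
theorem finite_setOf_intermediateField_algebraicClosure_finrank_le_adicCompletion (d : ℕ) :
    {E : IntermediateField (w.adicCompletion F) (AlgebraicClosure (w.adicCompletion F)) |
      FiniteDimensional (w.adicCompletion F) E ∧ finrank (w.adicCompletion F) E ≤ d}.Finite := by
  obtain ⟨p, hp, hpv⟩ := exists_prime_natCast_mem_asIdeal F w
  haveI : Fact p.Prime := ⟨hp⟩
  letI : Algebra ℚ_[p] (w.adicCompletion F) :=
    Literature.NumberTheory.GaloisRepresentations.LocalField.adicCompletionPadicAlgebra w p hpv
  haveI : FiniteDimensional ℚ_[p] (w.adicCompletion F) := by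
    apply Module.finite_of_finrank_pos
    rw [Literature.NumberTheory.NumberFields.finrank_adicCompletionPadicAlgebra_eq p w hpv]
    exact Nat.mul_pos (Ideal.ramificationIdx_pos _ _) (Ideal.inertiaDeg_pos _ _)
  exact Literature.FieldTheory.finite_setOf_intermediateField_algebraicClosure_finrank_le_padic p
    (w.adicCompletion F) d

/-- **`hfin` over a finite extension of a completion** (e.g. `K = L_w ⊇ L⁺_v`): for every field `K`
finite over `w.adicCompletion F`, the intermediate fields `K ⊆ E ⊆ AlgebraicClosure K` of
`K`-degree `≤ d` form a finite set. [cite: BombieriGubler2006, Prop 4.5.3] -/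
theorem finite_setOf_intermediateField_algebraicClosure_finrank_le_of_finite_adicCompletion
    (K : Type) [Field K] [Algebra (w.adicCompletion F) K] [FiniteDimensional (w.adicCompletion F) K]
    (d : ℕ) :
    {E : IntermediateField K (AlgebraicClosure K) |
      FiniteDimensional K E ∧ finrank K E ≤ d}.Finite := by
  obtain ⟨p, hp, hpv⟩ := exists_prime_natCast_mem_asIdeal F w
  haveI : Fact p.Prime := ⟨hp⟩
  letI : Algebra ℚ_[p] (w.adicCompletion F) :=
    Literature.NumberTheory.GaloisRepresentations.LocalField.adicCompletionPadicAlgebra w p hpv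
  haveI : FiniteDimensional ℚ_[p] (w.adicCompletion F) := by
    apply Module.finite_of_finrank_pos
    rw [Literature.NumberTheory.NumberFields.finrank_adicCompletionPadicAlgebra_eq p w hpv]
    exact Nat.mul_pos (Ideal.ramificationIdx_pos _ _) (Ideal.inertiaDeg_pos _ _)
  letI : Algebra ℚ_[p] K := ((algebraMap (w.adicCompletion F) K).comp (algebraMap ℚ_[p] _)).toAlgebra
  haveI : IsScalarTower ℚ_[p] (w.adicCompletion F) K := IsScalarTower.of_algebraMap_eq fun _ => rfl
  haveI : FiniteDimensional ℚ_[p] K := Module.Finite.trans (w.adicCompletion F) K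
  exact Literature.FieldTheory.finite_setOf_intermediateField_algebraicClosure_finrank_le_padic p K d

end Literature.NumberTheory.LocalFields

end
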